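import Literature.Barriers.Parity.SiegelZeroDichotomyPairHLProp81
import Literature.Barriers.Parity.SiegelZeroDichotomyPairHLProp81Kernel
import Literature.Barriers.Parity.SiegelZeroDichotomyPairHLProp81Model
import HarnessLib

/-!
# Tao–Teräväinen 2022, Proposition 8.1 (`k = 2`), sum level: from the three kernel bounds

Topic `Literature/Barriers/Parity`, sub-namespace `TaoTeravainen`; assembly of Proposition 8.1 in the proof
DAG of `Literature.Barriers.Parity.TaoTeravainen2021_prop72_81_pair` (T. Tao, J. Teräväinen, *The
Hardy–Littlewood–Chowla conjecture in the presence of a Siegel zero*, J. London Math. Soc. (2) 106 (2022),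
arXiv:2109.06291), §8. This file plugs the piecewise error of `…Prop81Kernel.lean` (built from the three
kernel bounds `KB1`–`KB3` on `K(τ) = ∏_{p<N} E_p(τ)` and the model bound of `…Prop81Model.lean`) into the
sum-level assembly `abs_sharpCorr_sub_le_of_euler` (`…Prop81.lean`). Everything here is PROVED; the three
kernel bounds — the crude bound "`∏_p E_p ≪ log^{O(1)} R`", the refined bound (8.20) and the
asymptotic (8.25) — are the HYPOTHESES `hKB1`, `hKB2`, `hKB3`:

* **`abs_sharpCorr_sub_le_of_kernelBounds`** —
  `|∑_{n≤x} Λ♯(n+h₁)Λ♯(n+h₂) − 𝔖' x| ≤ E_χ + E_CRT + (ε_K + |𝔖'|(2ε+ε²)) x + (M_crude + |𝔖'|) x₁` with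
  `ε_K = X⁻² (A₃ ∏_k I_k + (A₂ + |𝔖'|A₄) Σ(T') + A₁X² Σ(T))`, `A₄ = (2π)⁴e^{2c₀}`.
  [cite: TaoTeravainen2021, Proposition 8.1 and §8 (8.19)–(8.25)]
-/

noncomputable section

open Finset Real MeasureTheory Complex

namespace Literature.Barriers.Parity

namespace TaoTeravainen

variable {q : ℕ}

/-- The model constant `A₄ = (2π)⁴ e^{2c₀}`. [cite: TaoTeravainen2021, §3.1 (3.2)] -/
def modelA₄ : ℝ := (2 * π) ^ 4 * Real.exp modelConst ^ 2

/-- `0 ≤ A₄`. [folklore] -/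
theorem modelA₄_nonneg : 0 ≤ modelA₄ := by unfold modelA₄; positivity

/-- The kernel error level `ε_K = X⁻² (A₃ ∏_k I_k + (A₂ + |𝔖'|A₄) Σ(T') + A₁X² Σ(T))`.
[cite: TaoTeravainen2021, §8 (8.19)–(8.25)] -/
def kernelEps (M Cs : ℕ → ℝ) (X U₀ : ℝ) (κ nd : ℕ) (T T' A₁ A₂ A₃ S' : ℝ) : ℝ :=
  (X ^ 2)⁻¹ * (A₃ * ∏ k : Slot, slotI M Cs X U₀ κ k + (A₂ + |S'| * modelA₄) * tailSum M Cs X U₀ κ nd T' +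
    A₁ * X ^ 2 * tailSum M Cs X U₀ κ nd T)

/-- **Proposition 8.1 at `k = 2`, sum level, from the three kernel bounds.** Hypotheses as in
`abs_sharpCorr_sub_le_of_euler`, with `N > e^X` (so that `…Prop81Model.lean` applies; `X ≥ 2` follows from
`2 ≤ U₀`, `2U₀+2 ≤ X`), the sieve-transform decay constants `C_n`, the exponents `κ ≥ 2`, `nd`, the levels
`0 ≤ T' , T`, and the kernel bounds `hKB1` (everywhere), `hKB2` (on `|t| ≤ T`), `hKB3` (on `|t| ≤ T'`) for
`K(τ) = ∏_{p<N} E_p(τ)` with constants `A₁, A₂, A₃ ≥ 0`. [cite: TaoTeravainen2021, Proposition 8.1, §8 (8.19)–(8.25)] -/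
theorem abs_sharpCorr_sub_le_of_kernelBounds (χ : DirichletCharacter ℂ q) (hχq : χ.IsQuadratic) {φ ψ : ℝ → ℝ}
    (hφ : IsBump φ) (hψ : IsSmoothCutoff ψ) {B₀ B₁ Bψ : ℝ} (hB₀ : ∀ u, |φ u| ≤ B₀) (hB₁ : ∀ u, |deriv φ u| ≤ B₁)
    (hBψ : ∀ u, |ψ u| ≤ Bψ) {M : ℕ → ℝ} (hM : ∀ i u, |iteratedDeriv i ψ u| ≤ M i)
    {Cs : ℕ → ℝ} (hCs : ∀ n τ, (1 + |τ|) ^ n * ‖sieveFourier ψ τ‖ ≤ Cs n)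
    {X U₀ : ℝ} (hU₀ : 2 ≤ U₀) (hX : 2 * U₀ + 2 ≤ X) (hX3 : 3 * U₀ ≤ X) {R : ℝ} (hR : 1 < R)
    {h₁ h₂ : ℕ} (hne : h₁ ≠ h₂) {x₁ x : ℕ} (hx₁ : x₁ ≤ x)
    (hxX₁ : Real.log ((x + h₁ : ℕ) : ℝ) ≤ X + 1) (hxX₂ : Real.log ((x + h₂ : ℕ) : ℝ) ≤ X + 1)
    {δ : ℝ} (hδ : 0 < δ) (hlo : X - U₀ + 1 + δ ≤ Real.log ((x₁ + 1 : ℕ) : ℝ))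
    (hhi₁ : Real.log ((x + h₁ : ℕ) : ℝ) + δ ≤ X + U₀ - 1) (hhi₂ : Real.log ((x + h₂ : ℕ) : ℝ) + δ ≤ X + U₀ - 1)
    {Dmax : ℕ} (hDmax₁ : Real.exp (Real.log ((x + h₁ : ℕ) : ℝ) - X + 2 * U₀ + 1) ≤ Dmax)
    (hDmax₂ : Real.exp (Real.log ((x + h₂ : ℕ) : ℝ) - X + 2 * U₀ + 1) ≤ Dmax)
    {A N : ℕ} (hA : 1 ≤ A) (hAD : Dmax < 2 ^ (A + 1)) (hN : max Dmax ⌈R⌉₊ < N) (hNX : Real.exp X < N)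
    {C₀ : ℝ} (hC₀ : 1 ≤ C₀) (hζ₀ : ∀ σ : ℂ, ‖σ‖ ≤ 1 → ‖riemannZeta₀ (1 + σ)‖ ≤ C₀) {τ₀ : ℝ} (hτ₀ : 0 < τ₀)
    (hsmall : X⁻¹ + 2 * π * τ₀ ≤ 1 / (2 * C₀)) {nn : ℕ} (hnn : 3 ≤ nn)
    {L : ℝ} (hL0 : 0 ≤ L) (hLD : Real.log Dmax ≤ L) (hLx₁ : Real.log ((x + h₁ : ℕ) : ℝ) ≤ L)
    (hLx₂ : Real.log ((x + h₂ : ℕ) : ℝ) ≤ L)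
    {Eχ : ℝ}
    (hχ : |∑ n ∈ Icc 1 x, vonMangoldtSiegelSharp χ φ ψ X U₀ R (n + h₁) * vonMangoldtSiegelSharp χ φ ψ X U₀ R (n + h₂) -
        ∑ n ∈ Icc 1 x, (sharpB χ φ ψ X U₀ Dmax (n + h₁) * selbergSieve ψ R (n + h₁)) *
          (sharpB χ φ ψ X U₀ Dmax (n + h₂) * selbergSieve ψ R (n + h₂))| ≤ Eχ)
    {κ nd : ℕ} (hκ : 2 ≤ κ) {T T' A₁ A₂ A₃ : ℝ} (hT : 0 ≤ T) (hT' : 0 ≤ T') (hA₁ : 0 ≤ A₁) (hA₂ : 0 ≤ A₂)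
    (hA₃ : 0 ≤ A₃) {S' : ℝ}
    (hKB1 : ∀ τ : Slot → ℝ,
      ‖∏ p ∈ Nat.primesBelow N, MainTerm.localE p ((shiftDiff h₁ h₂).factorization p) A (realChar χ p)
          (fun j => npow (slotExpo X R (j, 0) (τ (j, 0))) p)
          (fun j => npow (slotExpo X R (j, 1) (τ (j, 1))) p)
          (fun j => npow (slotExpo X R (j, 2) (τ (j, 2))) p)‖ ≤ A₁)
    (hKB2 : ∀ τ : Slot → ℝ, (∀ k, |τ k| ≤ boxThr X T k) →
      ‖∏ p ∈ Nat.primesBelow N, MainTerm.localE p ((shiftDiff h₁ h₂).factorization p) A (realChar χ p)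
          (fun j => npow (slotExpo X R (j, 0) (τ (j, 0))) p)
          (fun j => npow (slotExpo X R (j, 1) (τ (j, 1))) p)
          (fun j => npow (slotExpo X R (j, 2) (τ (j, 2))) p)‖ ≤ A₂ * (X ^ 2)⁻¹ * polyWeight X κ τ)
    (hKB3 : ∀ τ : Slot → ℝ, (∀ k, |τ k| ≤ boxThr X T' k) →
      ‖(∏ p ∈ Nat.primesBelow N, MainTerm.localE p ((shiftDiff h₁ h₂).factorization p) A (realChar χ p)
          (fun j => npow (slotExpo X R (j, 0) (τ (j, 0))) p)
          (fun j => npow (slotExpo X R (j, 1) (τ (j, 1))) p)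
          (fun j => npow (slotExpo X R (j, 2) (τ (j, 2))) p)) -
        (S' : ℂ) * ∏ j : Fin 2, eulerTrunc N (zetaSlotS X (τ (j, 0)))‖ ≤ A₃ * (X ^ 2)⁻¹ * polyWeight X κ τ) :
    |∑ n ∈ Icc 1 x, vonMangoldtSiegelSharp χ φ ψ X U₀ R (n + h₁) * vonMangoldtSiegelSharp χ φ ψ X U₀ R (n + h₂) -
        S' * x| ≤
      Eχ + Bψ ^ 4 * (psiAbelConst B₀ B₁ Bψ X) ^ 2 * (#(sharpTriples R Dmax) : ℝ) ^ 2 +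
        ((kernelEps M Cs X U₀ κ nd T T' A₁ A₂ A₃ S' +
            |S'| * (2 * moebiusSlotErr M X U₀ C₀ τ₀ nn + moebiusSlotErr M X U₀ C₀ τ₀ nn ^ 2)) * x +
          (Bψ ^ 4 * (Int.natAbs ((h₁ : ℤ) - h₂) : ℝ) * (2 * Bψ * B₀ * (L + 1)) ^ 2 *
              (tripleGcdSum 1 (sharpTriples R Dmax)) ^ 2 + |S'|) * x₁) := by
  have hX2 : 2 ≤ X := by linarith
  have hX0 : 0 < X := by linarith
  have hU₀1 : 1 ≤ U₀ := by linarith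
  have hXU : U₀ ≤ X := by linarith
  have hM0 : ∀ i, 0 ≤ M i := fun i => (abs_nonneg _).trans (hM i 0)
  have hCs0 : ∀ n, 0 ≤ Cs n := fun n => le_trans (by positivity) (hCs n 0)
  -- the model bound and the piecewise error
  have hMB : ∀ τ : Slot → ℝ, ‖∏ j : Fin 2, eulerTrunc N (zetaSlotS X (τ (j, 0)))‖ ≤
      modelA₄ * (X ^ 2)⁻¹ * ∏ j : Fin 2, (1 + X * |τ (j, 0)|) ^ 2 := fun τ => norm_prod_eulerTrunc_le hX2 hNX τ
  set err := kernelErr X T T' A₁ A₂ A₃ modelA₄ S' κ with herr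
  have hK := kernelErr_bound hX0 hA₁ hA₂ hA₃ modelA₄_nonneg hκ hKB1 hKB2 hKB3 hMB
  -- integrability and size of `err · |W_n|` for bulk `n`
  have hlog_le : ∀ {n : ℕ} (h : ℕ), n ≤ x → Real.log ((n : ℝ) + h) ≤ Real.log ((x + h : ℕ) : ℝ) := by
    intro n h hnx
    by_cases h0 : (n : ℝ) + h = 0
    · rw [h0, Real.log_zero]; exact Real.log_natCast_nonneg _
    · refine Real.log_le_log (lt_of_le_of_ne (by positivity) (Ne.symm h0)) ?_
      push_cast; gcongr
  have herrW : ∀ n ∈ Icc (x₁ + 1) x, Integrable (fun τ => err τ * ‖sixWeight φ ψ X U₀ h₁ h₂ n τ‖) ∧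
      ∫ τ, err τ * ‖sixWeight φ ψ X U₀ h₁ h₂ n τ‖ ≤ kernelEps M Cs X U₀ κ nd T T' A₁ A₂ A₃ S' := by
    intro n hn
    rw [mem_Icc] at hn
    have hc : ∀ j : Fin 2, Real.log ((n : ℝ) + (if j = 0 then h₁ else h₂ : ℕ)) ≤ X + 1 := by
      intro j; fin_cases j
      · simpa using (hlog_le h₁ hn.2).trans hxX₁
      · simpa using (hlog_le h₂ hn.2).trans hxX₂
    have h := integral_kernelErr_mul_norm_sixWeight_le hφ hψ hM hCs hU₀1 hX hXU h₁ h₂ hc κ nd hT hT' hA₁ hA₂ hA₃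
      modelA₄_nonneg S'
    exact ⟨h.1, h.2.trans (le_of_eq rfl)⟩
  -- the level is nonnegative
  have hεK0 : 0 ≤ kernelEps M Cs X U₀ κ nd T T' A₁ A₂ A₃ S' := by
    have hI0 : ∀ k, 0 ≤ slotI M Cs X U₀ κ k := fun k => by
      unfold slotI; split_ifs
      · have := psiDecayConst_nonneg hM0 (by linarith : (0:ℝ) ≤ U₀) (by linarith : 0 ≤ X + 2 * U₀) (κ + 2); positivity
      · exact mul_nonneg (hCs0 _) Real.pi_pos.le
    have hJ0 : ∀ θ, 0 ≤ θ → ∀ k, 0 ≤ slotJ M Cs X U₀ κ nd θ k := fun θ hθ k => by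
      unfold slotJ; split_ifs
      · have := psiDecayConst_nonneg hM0 (by linarith : (0:ℝ) ≤ U₀) (by linarith : 0 ≤ X + 2 * U₀) (κ + nd + 2); positivity
      · have := hCs0 (κ + nd + 2); positivity
    have hTS : ∀ θ, 0 ≤ θ → 0 ≤ tailSum M Cs X U₀ κ nd θ := fun θ hθ =>
      sum_nonneg fun k _ => mul_nonneg (hJ0 θ hθ k) (prod_nonneg fun k' _ => hI0 k')
    unfold kernelEps
    have := hTS T hT; have := hTS T' hT'
    have : 0 ≤ ∏ k : Slot, slotI M Cs X U₀ κ k := prod_nonneg fun k _ => hI0 k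
    have : 0 ≤ A₂ + |S'| * modelA₄ := by have := modelA₄_nonneg; positivity
    positivity
  exact abs_sharpCorr_sub_le_of_euler χ hχq hφ hψ hB₀ hB₁ hBψ hM hU₀ hX hX3 hR hne hx₁ hxX₁ hxX₂ hδ hlo hhi₁ hhi₂
    hDmax₁ hDmax₂ hA hAD hN hC₀ hζ₀ hτ₀ hsmall hnn hL0 hLD hLx₁ hLx₂ hχ hK hεK0 herrW

end TaoTeravainen

end Literature.Barriers.Parity
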